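import Summits.ValiantsHypothesis.ValiantsHypothesis.Theorems.KPlusLogSqLawWindowDescartesSigns

/-!
# Window Descartes rule — part 2: `signVariations` as `sgnChanges`, the smoothing lemma, roots from sign changes

Continuation of `…WindowDescartesSigns` (seat val-sym-lift-p4 (g2), GAP-LIFT §7): (4) Mathlib's
`Polynomial.signVariations P` is `sgnChanges` of the coefficient list (`signVariations_eq_sgnChanges_coeffList`,
`signVariations_eq_sgnChanges_slist`); (5) the VARIATION-DIMINISHING property of a positive first-order recurrence
`v (k+1) = ρ_k · v k + w (k+1)` (`sgnChanges_slist_le_of_rec` — the one-sided geometric-kernel step of Laguerre's proof of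
Descartes' rule, here with variable positive ratio; the finite core `smoothing_core` is a statement about five signs checked
by `decide`); (6) sign changes of the values of a real polynomial along an increasing list of positive points are bounded by
the number of distinct roots above the first point (intermediate value theorem), hence by Descartes' count
(`sgnChanges_eval_le_signVariations`, via Mathlib's `Polynomial.roots_countP_pos_le_signVariations`).  HONEST FRAMING:
elementary facts about real polynomials; no statement of the cell is touched. [folklore; Pólya–Szegő, Problems and
Theorems in Analysis II, Part V, Ch. 1]
-/

set_option linter.dupNamespace false
set_option autoImplicit false

namespace Summit.ValiantsHypothesis.ValiantsHypothesis.Theorems.KPlusLogSqLaw.WindowDescartes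

open Polynomial

/-! ## 4. Identification with Mathlib's `Polynomial.signVariations` -/

/-- auxiliary (sgnChanges replicate zero append). [folklore] -/
theorem sgnChanges_replicate_zero_append (k : ℕ) (L : List ℝ) : sgnChanges (List.replicate k 0 ++ L) = sgnChanges L := by
  induction k with
  | zero => rfl
  | succ k ih => rw [List.replicate_succ, List.cons_append, sgnChanges_cons_zero, ih]

/-- auxiliary (firstNZ replicate zero append). [folklore] -/
theorem firstNZ_replicate_zero_append (k : ℕ) (L : List ℝ) : firstNZ (List.replicate k 0 ++ L) = firstNZ L := by
  induction k with
  | zero => rfl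
  | succ k ih => rw [List.replicate_succ, List.cons_append, firstNZ_cons_zero, ih]

/-- auxiliary (firstNZ coeffList). [folklore] -/
theorem firstNZ_coeffList (Q : ℝ[X]) : firstNZ Q.coeffList = Q.leadingCoeff := by
  by_cases hQ : Q = 0
  · simp [hQ]
  · obtain ⟨ls, hls⟩ := coeffList_eq_cons_leadingCoeff hQ
    rw [hls, firstNZ_cons_of_ne_zero (leadingCoeff_ne_zero.mpr hQ)]

/-- for `u ≠ 0`: `sign u = − sign v ↔ u · v < 0`. -/
theorem sign_eq_neg_sign_iff_mul_neg {u : ℝ} (hu : u ≠ 0) (v : ℝ) : SignType.sign u = -SignType.sign v ↔ u * v < 0 := by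
  rcases hu.lt_or_gt with hu | hu <;> rcases lt_trichotomy v 0 with hv | rfl | hv
  · rw [sign_neg hu, sign_neg hv]
    exact ⟨fun h => absurd h (by decide), fun h => absurd h (not_lt.mpr (mul_pos_of_neg_of_neg hu hv).le)⟩
  · rw [sign_neg hu, sign_zero, mul_zero]; exact ⟨fun h => absurd h (by decide), fun h => absurd h (lt_irrefl 0)⟩
  · rw [sign_neg hu, sign_pos hv]; exact ⟨fun _ => mul_neg_of_neg_of_pos hu hv, fun _ => by decide⟩
  · rw [sign_pos hu, sign_neg hv]; exact ⟨fun _ => mul_neg_of_pos_of_neg hu hv, fun _ => by decide⟩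
  · rw [sign_pos hu, sign_zero, mul_zero]; exact ⟨fun h => absurd h (by decide), fun h => absurd h (lt_irrefl 0)⟩
  · rw [sign_pos hu, sign_pos hv]
    exact ⟨fun h => absurd h (by decide), fun h => absurd h (not_lt.mpr (mul_pos hu hv).le)⟩

/-- **Mathlib's `signVariations` is `sgnChanges` of the coefficient list.** -/
theorem signVariations_eq_sgnChanges_coeffList (P : ℝ[X]) : P.signVariations = sgnChanges P.coeffList := by
  induction hc : P.support.card using Nat.strong_induction_on generalizing P with
  | _ c ih =>
    by_cases hP : P = 0
    · subst hP; simp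
    have hlt : P.eraseLead.support.card < c := by
      have h := card_support_eraseLead_add_one hP
      omega
    rw [signVariations_eq_eraseLead_add_ite hP, coeffList_eraseLead hP, sgnChanges_cons,
      sgnChanges_replicate_zero_append, firstNZ_replicate_zero_append, firstNZ_coeffList,
      ih _ hlt _ rfl]
    simp only [sign_eq_neg_sign_iff_mul_neg (leadingCoeff_ne_zero.mpr hP)]

/-- auxiliary (coeffList eq slist). [folklore] -/
theorem coeffList_eq_slist {P : ℝ[X]} (hP : P ≠ 0) : P.coeffList = slist P.coeff P.natDegree := by
  simp only [coeffList, withBotSucc_degree_eq_natDegree_add_one hP]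
  rfl

/-- auxiliary (sgnChanges slist zero fun). [folklore] -/
theorem sgnChanges_slist_zero_fun (n : ℕ) : sgnChanges (slist (fun _ => (0 : ℝ)) n) = 0 := by
  induction n with
  | zero => simp
  | succ n ih => rw [slist_succ, sgnChanges_cons_zero, ih]

/-- **`signVariations` from the coefficient sequence**: for any `n ≥ natDegree P`,
`P.signVariations = sgnChanges [P.coeff n, …, P.coeff 0]`. -/
theorem signVariations_eq_sgnChanges_slist (P : ℝ[X]) {n : ℕ} (hn : P.natDegree ≤ n) :
    P.signVariations = sgnChanges (slist P.coeff n) := by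
  by_cases hP : P = 0
  · subst hP
    rw [signVariations_zero]
    exact (sgnChanges_slist_zero_fun n).symm
  obtain ⟨m, rfl⟩ := Nat.exists_eq_add_of_le hn
  rw [signVariations_eq_sgnChanges_coeffList, coeffList_eq_slist hP]
  induction m with
  | zero => rfl
  | succ m ih =>
    rw [show P.natDegree + (m + 1) = (P.natDegree + m) + 1 by ring, slist_succ,
      coeff_eq_zero_of_natDegree_lt (by omega), sgnChanges_cons_zero, ih (by omega)]

/-! ## 5. Variation diminishing of a positive first-order recurrence -/

/-- the finite core of the smoothing lemma: one step of the invariant, as a statement about five signs. -/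
theorem smoothing_core (sv sw tv tw u : SignType) (hu : u ≠ 0 → sv = u) (h1 : tw = 0 → tv = u)
    (h2 : tv = 0 → tw ≠ 0 → u = -tw) (h3 : tv ≠ 0 → tw ≠ 0 → tv ≠ tw → u = tv) (h4 : u = 0 → tv = tw) :
    (if tv * sv = -1 then 1 else 0) + (if (if tv = 0 then sv else tv) ≠ (if tw = 0 then sw else tw) then 1 else 0)
      ≤ (if sv ≠ sw then 1 else 0) + (if tw * sw = -1 then 1 else 0) := by
  cases sv <;> cases sw <;> cases tv <;> cases tw <;> cases u <;> revert hu h1 h2 h3 h4 <;> decide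

/-- **Smoothing lemma (variation diminishing).**  If `v (k+1) = ρ_k · v k + w (k+1)` with all `ρ_k > 0` and `v 0`, `w 0`
have the same sign, then `[v n, …, v 0]` has at most as many sign changes as `[w n, …, w 0]`. [folklore; the
one-sided geometric-kernel step of Laguerre's proof of Descartes' rule] -/
theorem sgnChanges_slist_le_of_rec (ρ v w : ℕ → ℝ) (hρ : ∀ k, 0 < ρ k)
    (h0 : SignType.sign (v 0) = SignType.sign (w 0)) (n : ℕ) (hrec : ∀ k, k < n → v (k + 1) = ρ k * v k + w (k + 1)) :
    sgnChanges (slist v n) ≤ sgnChanges (slist w n) := by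
  have key : ∀ m, m ≤ n → sgnChanges (slist v m) +
      (if SignType.sign (firstNZ (slist v m)) ≠ SignType.sign (firstNZ (slist w m)) then 1 else 0) ≤
        sgnChanges (slist w m) := by
    intro m hm
    induction m with
    | zero =>
      have e : SignType.sign (firstNZ (slist v 0)) = SignType.sign (firstNZ (slist w 0)) := by
        rw [slist_zero, slist_zero, firstNZ_cons, firstNZ_cons, firstNZ_nil]
        by_cases hv : v 0 = 0
        · have hw : w 0 = 0 := by rw [← sign_eq_zero_iff, ← h0, sign_eq_zero_iff]; exact hv
          rw [if_pos hv, if_pos hw]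
        · have hw : w 0 ≠ 0 := by rw [Ne, ← sign_eq_zero_iff, ← h0, sign_eq_zero_iff]; exact hv
          rw [if_neg hv, if_neg hw]; exact h0
      rw [if_neg (not_not_intro e), slist_zero, slist_zero, sgnChanges_singleton, sgnChanges_singleton]
    | succ k ih =>
      have ih := ih (Nat.le_of_succ_le hm)
      have hk : k < n := Nat.lt_of_succ_le hm
      set sv := SignType.sign (firstNZ (slist v k)) with hsv
      set sw := SignType.sign (firstNZ (slist w k)) with hsw
      set tv := SignType.sign (v (k + 1)) with htv
      set tw := SignType.sign (w (k + 1)) with htw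
      set u := SignType.sign (v k) with hu'
      have hu : u ≠ 0 → sv = u := fun h => by
        have hvk : v k ≠ 0 := fun h' => h (by rw [hu', h', sign_zero])
        rw [hsv, firstNZ_slist_of_ne_zero hvk]
      have h1 : tw = 0 → tv = u := fun h => by
        have hw0 : w (k + 1) = 0 := sign_eq_zero_iff.mp h
        rw [htv, hu', hrec k hk, hw0, add_zero, sign_mul, sign_pos (hρ k), one_mul]
      have h2 : tv = 0 → tw ≠ 0 → u = -tw := fun ht _ => by
        have hv0 : v (k + 1) = 0 := sign_eq_zero_iff.mp ht
        have e : ρ k * v k = -w (k + 1) := by linarith [hrec k hk]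
        have e' : SignType.sign (ρ k * v k) = SignType.sign (-w (k + 1)) := by rw [e]
        rwa [sign_mul, sign_pos (hρ k), one_mul, Left.sign_neg] at e'
      have h3 : tv ≠ 0 → tw ≠ 0 → tv ≠ tw → u = tv := by
        intro ha hb hab
        have e : ρ k * v k = v (k + 1) - w (k + 1) := by linarith [hrec k hk]
        rcases lt_trichotomy (v (k + 1)) 0 with hv | hv | hv
        · have htv' : tv = -1 := by rw [htv, sign_neg hv]
          have hw : 0 < w (k + 1) := by
            rcases lt_trichotomy (w (k + 1)) 0 with hw | hw | hw
            · exact absurd (by rw [htv', htw, sign_neg hw]) hab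
            · exact absurd (by rw [htw, hw, sign_zero]) hb
            · exact hw
          have hvk : v k < 0 := by
            by_contra hge
            push Not at hge
            have := mul_nonneg (hρ k).le hge
            linarith
          rw [htv', hu']
          exact sign_neg hvk
        · exact absurd (by rw [htv, hv, sign_zero]) ha
        · have htv' : tv = 1 := by rw [htv, sign_pos hv]
          have hw : w (k + 1) < 0 := by
            rcases lt_trichotomy (w (k + 1)) 0 with hw | hw | hw
            · exact hw
            · exact absurd (by rw [htw, hw, sign_zero]) hb
            · exact absurd (by rw [htv', htw, sign_pos hw]) hab
          have hvk : 0 < v k := by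
            by_contra hle
            push Not at hle
            have := mul_nonpos_of_nonneg_of_nonpos (hρ k).le hle
            linarith
          rw [htv', hu']
          exact sign_pos hvk
      have h4 : u = 0 → tv = tw := fun h => by
        have hvk : v k = 0 := sign_eq_zero_iff.mp h
        rw [htv, htw, hrec k hk, hvk, mul_zero, zero_add]
      have hstep := smoothing_core sv sw tv tw u hu h1 h2 h3 h4
      have e1 : (v (k + 1) * firstNZ (slist v k) < 0) ↔ (tv * sv = -1) := mul_neg_iff_sign _ _
      have e2 : (w (k + 1) * firstNZ (slist w k) < 0) ↔ (tw * sw = -1) := mul_neg_iff_sign _ _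
      have e3 : SignType.sign (firstNZ (slist v (k + 1))) = (if tv = 0 then sv else tv) := by
        rw [slist_succ, firstNZ_cons]
        by_cases h : v (k + 1) = 0
        · rw [if_pos h, if_pos (by rw [htv, h, sign_zero])]
        · rw [if_neg h, if_neg (by rw [htv]; exact fun h' => h (sign_eq_zero_iff.mp h'))]
      have e4 : SignType.sign (firstNZ (slist w (k + 1))) = (if tw = 0 then sw else tw) := by
        rw [slist_succ, firstNZ_cons]
        by_cases h : w (k + 1) = 0
        · rw [if_pos h, if_pos (by rw [htw, h, sign_zero])]
        · rw [if_neg h, if_neg (by rw [htw]; exact fun h' => h (sign_eq_zero_iff.mp h'))]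
      rw [e3, e4, slist_succ v, slist_succ w, sgnChanges_cons, sgnChanges_cons]
      simp only [e1, e2]
      linarith [ih, hstep]
  exact le_trans (Nat.le_add_right _ _) (key n le_rfl)


/-! ## 6. Sign changes of the values of a polynomial along increasing points force distinct roots -/

/-- a sign change of the values between two points forces a root strictly between them. -/
theorem exists_isRoot_of_mul_eval_neg (Q : ℝ[X]) {x y : ℝ} (hxy : x < y) (h : Q.eval x * Q.eval y < 0) :
    ∃ z ∈ Set.Ioo x y, Q.IsRoot z := by
  have hcont : ContinuousOn (fun t => Q.eval t) (Set.Icc x y) := Q.continuous.continuousOn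
  rcases lt_or_gt_of_ne (show Q.eval x ≠ 0 from fun h0 => by simp [h0] at h) with hx | hx
  · have hy : 0 < Q.eval y := by
      by_contra hle; push Not at hle; exact absurd h (not_lt.mpr (mul_nonneg_of_nonpos_of_nonpos hx.le hle))
    obtain ⟨z, hz, hz0⟩ := intermediate_value_Ioo hxy.le hcont ⟨hx, hy⟩
    exact ⟨z, hz, hz0⟩
  · have hy : Q.eval y < 0 := by
      by_contra hle; push Not at hle; exact absurd h (not_lt.mpr (mul_nonneg hx.le hle))
    obtain ⟨z, hz, hz0⟩ := intermediate_value_Ioo' hxy.le hcont ⟨hy, hx⟩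
    exact ⟨z, hz, hz0⟩

/-- **sign changes along increasing points are witnessed by distinct roots**: if the values of `Q` at the points of an
increasing list `x :: xs` are all non-zero, the number of sign changes of the value list is at most the number of
distinct roots of `Q` above `x`. -/
theorem sgnChanges_eval_le_card_roots (Q : ℝ[X]) (x : ℝ) (xs : List ℝ) (hsort : (x :: xs).Pairwise (· < ·))
    (hne : ∀ y ∈ x :: xs, Q.eval y ≠ 0) :
    sgnChanges ((x :: xs).map fun t => Q.eval t) ≤ (Q.roots.toFinset.filter fun z => x < z).card := by
  induction xs generalizing x with
  | nil => simp
  | cons y xs ih =>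
    have hxy : x < y := List.rel_of_pairwise_cons hsort List.mem_cons_self
    have hsort' : (y :: xs).Pairwise (· < ·) := (List.pairwise_cons.mp hsort).2
    have hne' : ∀ t ∈ y :: xs, Q.eval t ≠ 0 := fun t ht => hne t (List.mem_cons_of_mem _ ht)
    have ih' := ih y hsort' hne'
    have hQ : Q ≠ 0 := fun h0 => hne x List.mem_cons_self (by simp [h0])
    have hy0 : Q.eval y ≠ 0 := hne y (List.mem_cons_of_mem _ List.mem_cons_self)
    have hsub : (Q.roots.toFinset.filter fun z => y < z) ⊆ (Q.roots.toFinset.filter fun z => x < z) := by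
      intro z hz
      rw [Finset.mem_filter] at hz ⊢
      exact ⟨hz.1, hxy.trans hz.2⟩
    rw [List.map_cons, List.map_cons, sgnChanges_cons, firstNZ_cons_of_ne_zero hy0]
    by_cases hch : Q.eval x * Q.eval y < 0
    · rw [if_pos hch]
      obtain ⟨z, hz, hzr⟩ := exists_isRoot_of_mul_eval_neg Q hxy hch
      have hzin : z ∈ (Q.roots.toFinset.filter fun z => x < z) := by
        rw [Finset.mem_filter, Multiset.mem_toFinset, mem_roots hQ]; exact ⟨hzr, hz.1⟩
      have hznot : z ∉ (Q.roots.toFinset.filter fun z => y < z) := by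
        rw [Finset.mem_filter]; exact fun h => absurd h.2 (not_lt.mpr hz.2.le)
      have hlt : (Q.roots.toFinset.filter fun z => y < z).card < (Q.roots.toFinset.filter fun z => x < z).card :=
        Finset.card_lt_card ⟨hsub, fun h => hznot (h hzin)⟩
      rw [List.map_cons] at ih'
      omega
    · rw [if_neg hch, add_zero]
      rw [List.map_cons] at ih'
      exact ih'.trans (Finset.card_le_card hsub)

/-- the count of roots above a non-negative point is at most Descartes' count of positive roots (with multiplicity). -/
theorem card_roots_filter_le_countP_pos (Q : ℝ[X]) {x : ℝ} (hx : 0 ≤ x) :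
    (Q.roots.toFinset.filter fun z => x < z).card ≤ Q.roots.countP (fun z => 0 < z) := by
  calc (Q.roots.toFinset.filter fun z => x < z).card
      ≤ (Q.roots.toFinset.filter fun z => 0 < z).card :=
        Finset.card_le_card (fun z hz => by
          rw [Finset.mem_filter] at hz ⊢; exact ⟨hz.1, hx.trans_lt hz.2⟩)
    _ = ((Q.roots.filter fun z => 0 < z).toFinset).card := by rw [Multiset.toFinset_filter]
    _ ≤ Multiset.card (Q.roots.filter fun z => 0 < z) := Multiset.toFinset_card_le _
    _ = Q.roots.countP (fun z => 0 < z) := (Multiset.countP_eq_card_filter _ _).symm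

/-- **Descartes along points**: for an increasing list of POSITIVE points at which `Q` does not vanish, the values of
`Q` change sign at most `signVariations Q` times. -/
theorem sgnChanges_eval_le_signVariations (Q : ℝ[X]) (xs : List ℝ) (hsort : xs.Pairwise (· < ·))
    (hpos : ∀ y ∈ xs, 0 < y) (hne : ∀ y ∈ xs, Q.eval y ≠ 0) :
    sgnChanges (xs.map fun t => Q.eval t) ≤ Q.signVariations := by
  cases xs with
  | nil => simp
  | cons x xs =>
    calc sgnChanges ((x :: xs).map fun t => Q.eval t)
        ≤ (Q.roots.toFinset.filter fun z => x < z).card := sgnChanges_eval_le_card_roots Q x xs hsort hne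
      _ ≤ Q.roots.countP (fun z => 0 < z) := card_roots_filter_le_countP_pos Q (hpos x List.mem_cons_self).le
      _ ≤ Q.signVariations := Q.roots_countP_pos_le_signVariations

end Summit.ValiantsHypothesis.ValiantsHypothesis.Theorems.KPlusLogSqLaw.WindowDescartes
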